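import Summits.ResolutionOfSingularities.ResolutionOfSingularities.Theorems.MaxContactCutFreezeCutDead
import Summits.ResolutionOfSingularities.ResolutionOfSingularities.Theorems.ExtinctionCutPort
import Summits.ResolutionOfSingularities.ResolutionOfSingularities.Theorems.StallVertexStraightClasses
import HarnessLib

/-!
# MaxContactCutExtinctionCut — decomp-res node «ExtinctionCut» (lens-3 g20, critic row 156), tree file 8/8 of the node

Content VERBATIM from the decomp-res lens-3 g20 node `HOME/decomp-res-lens-3/g20/ExtinctionCut.lean` (pin c917c20b =
`parts/ExtinctionCut-g20-c917c20b.lean`, 1 323 l; HOME = run/shared/lean/pub/decomp-res; lens imports = tree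
`MaxContactCutFreezeCut` +
`StallVertexStraightClasses` only; rc 0 · 0 sorry).  Critic: CRITIC-LEDGER row 156 (2026-08-31T00:18:27Z):
DECIDED-MOD-PORT +1 — the BALANCED
BOUNDARY CLASS `FreezeCut.NoBalancedBoundaryTailsDeep` decided AS A WHOLE modulo ONE typed port
`ExtinctionCut.KollarWallPort`.  Landing orders
INBOX :552 (critic) and :467 / :489 (the lens-3 g19 rev-4 blocks §D / §K7 = `FreezeCutDead` + classes add-on, land
first), `--kind proof --supports
stmt-ResolutionOfSingularities-31770` (`MaxContactCut.DefectWalksDeep`).  Files of the node, in import order: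
`FreezeCutDead` (§D, namespace
`…HoleCut.TailShade`, over the in-cone `MaxContactCutFreezeCut`) · `FreezeCutDeadClasses` (§K7 classes, cone-free,
namespace `…FreezeCut`) ·
`MaxContactCutFreezeCutDead` (§K7 kernels and EXACT iff's at 31770, Theses cone) · `ExtinctionCutToric` /
`ExtinctionCutToric2` (§1, Mathlib only,
namespace `…ExtinctionCut`) · `ExtinctionCutPort` (§2, the ONE typed port `KollarWallPort`, cone-free so that the
route file can cite it as an item) ·
`MaxContactCutExtinctionCut` (§3 booking at 31770, Theses cone; §M `closes` = tree
`MaxContactCutExponentLadder.closes` verbatim is omitted, as in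
`MaxContactCutFreezeCut`).  Aside bookkeeping (row 156 / INBOX :552): on the lens-3 column ONE typed PORT item
`KollarWallPort` and ONE live aside
`FreezeCut.NoSmallDeadStrictHighSkewJointTailsDeep` (home `FreezeCutDeadClasses`) superseding the rev-4 sub-class
pair; decided cells are THEOREMS and
are not filed.

## This file

§3 BOOKING (KERNEL, in the Theses cone; `section Booking` of `…Theorems.ExtinctionCut`, `open …Theorems.FreezeCut`):
`orbit_mem_of_not_inQuad` / `exists_seed_of_not_inQuad` (orbit tracking through the port's clauses K1a / K1b),
**`noBalancedBoundaryTails_of_port : KollarWallPort → NoBalancedBoundaryTailsDeep`** (the balanced boundary class is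
EMPTY modulo the port, by `witnessExtinction`), `highSkew_iff_smallDeadStrict_of_port`, the EXACT re-location
**`defectWalksDeep_iff_of_port : KollarWallPort → (MaxContactCut.DefectWalksDeep ↔ NoFreePointTailsDeep ∧
NoHighPlanarJointTailsDeep ∧ NoSmallDeadStrictHighSkewJointTailsDeep)`**, the lens-5 keys
`skew_iff_smallDeadStrict_of_port` (`CoefficientCut.NoSkewJointTailsDeep`) and
`monomialRegime_iff_smallDeadStrict_of_port` (`StallVertex.NoMonomialRegimeSkewStalledTailsDeep`, via
`StallVertex.skew_iff_monomialRegime`), `smallDeadStrict_of_defectWalksDeep`, and the honesty lemma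
`portData_consistent_constantWord` (the port's data are CONSISTENT: a constant word carries a non-extinct orbit, so
(K4) is used).  §M `closes` omitted (= tree `MaxContactCutExponentLadder.closes`).  Imports
`MaxContactCutFreezeCutDead` + `ExtinctionCutPort` + `StallVertexStraightClasses`; 0 sorry.

[WRITER NOTE (decomp-res writer g9): file split only (tree files ≤ 400 lines); namespaces, sections, section
variables and every declaration
exactly as in the lens (the lens's global opens are replayed per file; cone-free files carry the opens of
`FreezeCutClasses.lean`, the toric kernel none).]

(Sources: Kollar2007 (Lectures on Resolution of Singularities: Thm 1.93, Def 2.56, Rem 2.57, Claim 2.59.1, (2.59.2),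
Claim 2.59.4) [corpus:book:kollar2007-lectures-resolution-singularities pp. 54, 92–94]; Hauser2010Kangaroo
(arXiv:0811.4151); Moh1987; CossartPiltant2008 §2; CossartPiltant2019 Prop. 2.50; HauserPerlega2019 §1.)
-/

noncomputable section

open MvPolynomial Finset
open Literature.AlgebraicGeometry.Resolution
open Literature.AlgebraicGeometry.Resolution.Hauser2010
open Literature.AlgebraicGeometry.Resolution.PointBlowup
open Summit.ResolutionOfSingularities.ResolutionOfSingularities.Theses
open Summit.ResolutionOfSingularities.ResolutionOfSingularities.Theorems.TightDefectClasses
open Summit.ResolutionOfSingularities.ResolutionOfSingularities.Theorems.TightDefectStrongWalks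
open Summit.ResolutionOfSingularities.ResolutionOfSingularities.Theorems.ItineraryCutClasses
open Summit.ResolutionOfSingularities.ResolutionOfSingularities.Theorems.BoundaryLedger
open Summit.ResolutionOfSingularities.ResolutionOfSingularities.Theorems.ProximityCut
open Summit.ResolutionOfSingularities.ResolutionOfSingularities.Theorems.ConeCutAxisLaw
open Literature.AlgebraicGeometry.Resolution.WeightedBlowup
open Literature.Barriers.ResolutionOfSingularities
open Summit.ResolutionOfSingularities.ResolutionOfSingularities.Theorems.FloorCut
open Summit.ResolutionOfSingularities.ResolutionOfSingularities.Theorems.ConeCut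
open Summit.ResolutionOfSingularities.ResolutionOfSingularities.Theorems.ExitLaw (fin3_cases eq_of_le_of_degree_le)
open Summit.ResolutionOfSingularities.ResolutionOfSingularities.Theorems.ShadeCut
open Summit.ResolutionOfSingularities.ResolutionOfSingularities.Theorems.TightCut
open Summit.ResolutionOfSingularities.ResolutionOfSingularities.Theorems.HoleCut

namespace Summit.ResolutionOfSingularities.ResolutionOfSingularities.Theorems.ExtinctionCut

open Summit.ResolutionOfSingularities.ResolutionOfSingularities.Theorems.FreezeCut

section Booking

/-! ## §3 BOOKING — the balanced boundary class DECIDED modulo the port; EXACT re-location of 31770 (KERNEL) -/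

/-- Orbit tracking, forward: a stage-`0` support point whose orbit is still outside the quadrant at time `t` is a
stage-`t` support point (clause K1a iterated). [new] [folklore] -/
theorem orbit_mem_of_not_inQuad {w : ℕ → Bool} {S : ℕ → Set (ℤ × ℤ)}
    (hfwd : ∀ t, ∀ x ∈ S t, ¬ InQuad (step (w t) x) → step (w t) x ∈ S (t + 1))
    {x : ℤ × ℤ} (hx : x ∈ S 0) : ∀ t, ¬ InQuad (orbit w x t) → orbit w x t ∈ S t := by
  intro t
  induction t with
  | zero => intro _; rw [orbit_zero]; exact hx
  | succ t ih =>
    intro hq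
    rw [orbit_succ] at hq ⊢
    exact hfwd t _ (ih fun h => hq (inQuad_step _ h)) hq

/-- Orbit tracking, backward: a stage-`t` support point outside the quadrant is the time-`t` orbit point of a
stage-`0` support point outside the quadrant (clause K1b iterated). [new] [folklore] -/
theorem exists_seed_of_not_inQuad {w : ℕ → Bool} {S : ℕ → Set (ℤ × ℤ)}
    (hbwd : ∀ t, ∀ y ∈ S (t + 1), ¬ InQuad y → ∃ x ∈ S t, step (w t) x = y) :
    ∀ t, ∀ y ∈ S t, ¬ InQuad y → ∃ x ∈ S 0, ¬ InQuad x ∧ orbit w x t = y := by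
  intro t
  induction t with
  | zero => intro y hy hyq; exact ⟨y, hy, hyq, rfl⟩
  | succ t ih =>
    intro y hy hyq
    obtain ⟨x', hx', rfl⟩ := hbwd t y hy hyq
    obtain ⟨x, hx0, hxq, hxt⟩ := ih x' hx' fun h => hyq (inQuad_step _ h)
    exact ⟨x, hx0, hxq, by rw [orbit_succ, hxt]⟩

/-- **THE BALANCED BOUNDARY CLASS IS DECIDED (modulo the one port): there is no balanced boundary tail.**
Kernel route: port ↦ word + supports; proximity repeats (a binder of the class) switch letters (K4), so both letters
occur beyond every bound (§1 `both_letters_of_switches`); the seeds `⋃_i S i 0 ∖ ℕ²` lie in the box `[-s, ∞)²` (BOX)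
and their orbits satisfy `-s ≤ a + b` while outside `ℕ²` (K1a + K2) and trivially inside; §1 `witnessExtinction` puts
every seed orbit inside `ℕ²` from a uniform time `T` on; but isolation (K3) at stage `T` exhibits a support point
outside `ℕ²`, which by K1b descends from a seed — contradiction. [new] [folklore] -/
theorem noBalancedBoundaryTails_of_port (hπ : KollarWallPort) : NoBalancedBoundaryTailsDeep := by
  intro p hp e he K _ _ _ _ s₀ hs W hW N hN hex hrec htr s hsN h3 h33 hq hskew hbal
  obtain ⟨N₁, hNN₁, w, S, hsw, hbox, hfwd, hbwd, hσ, hiso⟩ := hπ p hp e K s₀ hs W N hN hrec s hsN (by omega) hq hbal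
  have hswitch : ∀ M, ∃ t, M ≤ t ∧ w (t + 1) ≠ w t := by
    intro M
    obtain ⟨t, ht, hst⟩ := hrec (N₁ + M)
    refine ⟨t - N₁, by omega, hsw (t - N₁) ?_⟩
    rwa [Nat.add_sub_cancel' (by omega : N₁ ≤ t)]
  obtain ⟨hU, hV⟩ := both_letters_of_switches w hswitch
  set A : Set (ℤ × ℤ) := {x | ∃ i, i ≤ s ∧ x ∈ S i 0 ∧ ¬ InQuad x} with hA
  have hboxA : ∀ x ∈ A, -(s : ℤ) ≤ x.1 ∧ -(s : ℤ) ≤ x.2 := by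
    rintro x ⟨i, hi, hx, -⟩
    obtain ⟨h1, h2⟩ := hbox i hi x hx
    constructor <;> omega
  have hσA : ∀ x ∈ A, ∀ t, -(s : ℤ) ≤ (orbit w x t).1 + (orbit w x t).2 := by
    rintro x ⟨i, hi, hx, -⟩ t
    by_cases hq' : InQuad (orbit w x t)
    · unfold InQuad at hq'; omega
    · have := hσ i hi t _ (orbit_mem_of_not_inQuad (hfwd i hi) hx t hq'); omega
  obtain ⟨T, hT⟩ := witnessExtinction s w hU hV A hboxA hσA
  obtain ⟨i, hi, y, hy, hyq⟩ := hiso T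
  obtain ⟨x, hx0, hxq, hxt⟩ := exists_seed_of_not_inQuad (hbwd i hi) T y hy hyq
  exact hyq (hxt ▸ hT x ⟨i, hi, hx0, hxq⟩ T le_rfl)

/-- **EXACT RE-LOCATION, high-skew form (g19 K7 `highSkew_iff_balanced_smallDeadStrict` with the balanced half
discharged by the port).** [new] [folklore] -/
theorem highSkew_iff_smallDeadStrict_of_port (hπ : KollarWallPort) :
    NoHighSkewJointTailsDeep ↔ NoSmallDeadStrictHighSkewJointTailsDeep :=
  highSkew_iff_balanced_smallDeadStrict.trans
    ⟨fun h => h.2, fun h => ⟨noBalancedBoundaryTails_of_port hπ, h⟩⟩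

/-- **EXACT RE-LOCATION OF THE HOST ASIDE 31770 (`MaxContactCut.DefectWalksDeep`), modulo the one port:**
the residual of the skew joint axis is the single class `NoSmallDeadStrictHighSkewJointTailsDeep`
(strict half-critical cells `p^e + 2 ≤ 2s ≤ … `, `3s ≥ p^e + 3`, small dead support). [new] [folklore] -/
theorem defectWalksDeep_iff_of_port (hπ : KollarWallPort) :
    MaxContactCut.DefectWalksDeep ↔
      NoFreePointTailsDeep ∧ NoHighPlanarJointTailsDeep ∧ NoSmallDeadStrictHighSkewJointTailsDeep :=
  defectWalksDeep_iff_highPlanar_balanced_smallDeadStrict.trans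
    ⟨fun h => ⟨h.1, h.2.1, h.2.2.2⟩, fun h => ⟨h.1, h.2.1, noBalancedBoundaryTails_of_port hπ, h.2.2⟩⟩

/-- EXACT, keyed to lens-5's coefficient class (`CoefficientCut.NoSkewJointTailsDeep`), modulo the port. [new] [folklore] -/
theorem skew_iff_smallDeadStrict_of_port (hπ : KollarWallPort) :
    CoefficientCut.NoSkewJointTailsDeep ↔ NoSmallDeadStrictHighSkewJointTailsDeep :=
  skew_iff_balanced_smallDeadStrict.trans
    ⟨fun h => h.2, fun h => ⟨noBalancedBoundaryTails_of_port hπ, h⟩⟩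

/-- EXACT, keyed to lens-5's landed monomial-regime class (`StallVertex.skew_iff_monomialRegime`,
`Theorems/StallVertexStraightClasses.lean`), modulo the port. [new] [folklore] -/
theorem monomialRegime_iff_smallDeadStrict_of_port (hπ : KollarWallPort) :
    StallVertex.NoMonomialRegimeSkewStalledTailsDeep ↔ NoSmallDeadStrictHighSkewJointTailsDeep :=
  StallVertex.skew_iff_monomialRegime.symm.trans (skew_iff_smallDeadStrict_of_port hπ)

/-- The unconditional direction (sanity: the decided class is a CONSEQUENCE of the host aside). [new] [folklore] -/
theorem smallDeadStrict_of_defectWalksDeep (h : MaxContactCut.DefectWalksDeep) :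
    NoSmallDeadStrictHighSkewJointTailsDeep :=
  (defectWalksDeep_iff_highPlanar_balanced_smallDeadStrict.mp h).2.2.2

/-- HONESTY CHECK (the analogue of a `_false_without_` lemma): the toric data promised by the port are CONSISTENT for
a ONE-letter word — the `U`-fixed seed `(-1, 0)` of `a_2` persists forever outside `ℕ²` — so the contradiction in
`noBalancedBoundaryTails_of_port` genuinely consumes the class binder «proximity repeats beyond every bound» (via K4 and
the two-letter hypothesis of §1); the port does not smuggle `False`. [new] [folklore] -/
theorem portData_consistent_constantWord : ∃ (w : ℕ → Bool) (S : ℕ → ℕ → Set (ℤ × ℤ)),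
    (∀ i, i ≤ 2 → ∀ x ∈ S i 0, -(i : ℤ) ≤ x.1 ∧ -(i : ℤ) ≤ x.2) ∧
    (∀ i, i ≤ 2 → ∀ t, ∀ x ∈ S i t, ¬ InQuad (step (w t) x) → step (w t) x ∈ S i (t + 1)) ∧
    (∀ i, i ≤ 2 → ∀ t, ∀ y ∈ S i (t + 1), ¬ InQuad y → ∃ x ∈ S i t, step (w t) x = y) ∧
    (∀ i, i ≤ 2 → ∀ t, ∀ x ∈ S i t, -(i : ℤ) ≤ x.1 + x.2) ∧
    (∀ t, ∃ i, i ≤ 2 ∧ ∃ x ∈ S i t, ¬ InQuad x) := by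
  refine ⟨fun _ => true, fun i _ => if i = 2 then {((-1 : ℤ), (0 : ℤ))} else ∅, ?_, ?_, ?_, ?_, ?_⟩
  · intro i hi x hx
    dsimp only at hx
    split_ifs at hx with h
    · simp only [Set.mem_singleton_iff] at hx; subst hx; subst h; norm_num
    · simp at hx
  · intro i hi t x hx _
    dsimp only at hx ⊢
    split_ifs at hx ⊢ with h
    · simp only [Set.mem_singleton_iff] at hx ⊢; subst hx; simp [step]
    · simp at hx
  · intro i hi t y hy _
    dsimp only at hy ⊢
    split_ifs at hy ⊢ with h
    · simp only [Set.mem_singleton_iff] at hy; subst hy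
      exact ⟨((-1 : ℤ), (0 : ℤ)), by simp, by simp [step]⟩
    · simp at hy
  · intro i hi t x hx
    dsimp only at hx
    split_ifs at hx with h
    · simp only [Set.mem_singleton_iff] at hx; subst hx; subst h; norm_num
    · simp at hx
  · intro t
    exact ⟨2, le_rfl, ((-1 : ℤ), (0 : ℤ)), by simp, by simp [InQuad]⟩

end Booking

end Summit.ResolutionOfSingularities.ResolutionOfSingularities.Theorems.ExtinctionCut
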